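import Literature.AnabelianGeometry.SemiGraphs.TemperedPiFunctor
import Literature.AnabelianGeometry.SemiGraphs.TemperedPiEssSurj
import Literature.AnabelianGeometry.SemiGraphs.TemperedVerticial

/-!
# Proposition 3.6 (i)(ii) of [SemiAnbd]: existence of the tempered fundamental group chart

Assembly of the rung-1 construction: for a countable connected graph of anabelioids `𝒢` satisfying
the hypotheses of [SemiAnbd] Prop. 3.6, the tempered group `π₁^temp(𝒢) := lim_n Gal(𝒢_{∞,n}/𝒢)`
(`TemperedPiExistence.lean`) comes with an equivalence `B^temp(𝒢) ≌ B^temp(π₁^temp(𝒢))`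
(the fibre functor at the base vertex: fully faithful by `TemperedPiFunctor.lean`, essentially
surjective by `TemperedPiEssSurj.lean`), i.e. a `TemperedPiChart`; this proves the named fact
`ExistsTemperedPiChart` of `TemperedVerticial.lean`.
-/

namespace Literature.AnabelianGeometry.SemiGraphs

namespace ProfiniteSemiGraph

open CategoryTheory CategoryTheory.PreGaloisCategory Literature.AnabelianGeometry.Anabelioids
open scoped FintypeCatDiscrete

universe u

section SplitsSelf

variable {𝒢 : ProfiniteSemiGraph.{u}} (S : CovObj 𝒢)

/-- A point-transitive covering of a connected `𝒢` splits itself (stabilisers of all points of a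
fibre coincide). [cite: MochizukiSemiAnbd2006, Prop 3.6 p.38] -/
theorem CovObj.splits_self_of_htrans (hc : 𝒢.graph.IsConnected) (v₀ : 𝒢.graph.Vertex)
    (htrans : ∀ (v : 𝒢.graph.Vertex) (x x' : (S.SV v).obj.V), ∃ σ : S ⟶ S, (σ.fV v).hom.hom x = x') :
    S.Splits S := by
  refine ⟨fun v x g hgx s => ?_, fun e x g hgx s => ?_⟩
  · obtain ⟨σ, rfl⟩ := htrans v x s
    rw [← CovHom.fV_ρ, hgx]
  · obtain ⟨b, hbe, hb⟩ := SemiGraph.exists_abuts_of_isConnected hc v₀ e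
    obtain ⟨v, hv⟩ := Option.isSome_iff_exists.mp hb
    subst hbe
    obtain ⟨σ, hσ⟩ := htrans v ((S.glue b v hv).hom.hom.hom x) ((S.glue b v hv).hom.hom.hom s)
    have hs : (σ.fE _).hom.hom x = s := by
      apply Function.LeftInverse.injective (S.glue_inv_hom b v hv)
      rw [CovHom.glue_fE, hσ]
    rw [← hs, ← CovHom.fE_ρ, hgx]

end SplitsSelf

variable (𝒢 : ProfiniteSemiGraph.{u}) (h36 : 𝒢.Prop36Hypotheses)

/-- The tower levels split themselves. [cite: MochizukiSemiAnbd2006, Prop 3.6 p.38] -/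
theorem galoisLevelData_splits_self (n : ℕ) :
    ((𝒢.galoisLevelData h36).S n).Splits ((𝒢.galoisLevelData h36).S n) :=
  CovObj.splits_self_of_htrans _ h36.isConnected (𝒢.baseVertex h36) ((𝒢.galoisLevelData h36).htrans n)

/-- The tower levels are finite coverings. [cite: MochizukiSemiAnbd2006, Prop 3.6 p.38] -/
theorem galoisLevelData_isFinite (n : ℕ) : ((𝒢.galoisLevelData h36).S n).IsFinite :=
  𝒢.ofBObj_isFinite (𝒢.tower h36 n)

/-- The tower levels have nonempty fibres. [cite: MochizukiSemiAnbd2006, Prop 3.6 p.38] -/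
theorem galoisLevelData_hasNonemptyFibres (n : ℕ) : ((𝒢.galoisLevelData h36).S n).HasNonemptyFibres := by
  letI := SemiGraphOfAnabelioids.galoisCategory_bObj 𝒢.toAnab ⟨h36.isConnected⟩
  have hV : ∀ v, Nonempty (((𝒢.galoisLevelData h36).S n).SV v).obj.V := fun v => by
    haveI := 𝒢.fiberFunctor_fiberAt h36.isConnected v
    haveI := 𝒢.isGalois_tower h36 n
    exact nonempty_fiber_of_isConnected (𝒢.fiberAt v) (𝒢.tower h36 n)
  refine ⟨hV, fun e => ?_⟩
  obtain ⟨b, hbe, hb⟩ := SemiGraph.exists_abuts_of_isConnected h36.isConnected (𝒢.baseVertex h36) e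
  obtain ⟨v, hv⟩ := Option.isSome_iff_exists.mp hb
  subst hbe
  obtain ⟨x⟩ := hV v
  exact ⟨(((𝒢.galoisLevelData h36).S n).glue b v hv).inv.hom.hom x⟩

/-- **The fibre functor is essentially surjective.** [cite: MochizukiSemiAnbd2006, Prop 3.6(ii) p.38] -/
theorem temperedFibreFunctor_essSurj : (𝒢.temperedFibreFunctor h36).EssSurj where
  mem_essImage X := by
    let D := 𝒢.galoisLevelData h36
    have hS := 𝒢.galoisLevelData_splits_self h36
    let T : BTempCat 𝒢 := ⟨D.realize h36.isCountable X,
      D.realize_isTempered h36.isCountable X hS (𝒢.galoisLevelData_isFinite h36)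
        (𝒢.galoisLevelData_hasNonemptyFibres h36)⟩
    exact ⟨T, ⟨D.fibreObjIsoOfLev h36.isCountable (D.realize h36.isCountable X) _ _ _ _ ≪≫
      D.realizeIso h36.isCountable X hS⟩⟩

/-- **The fibre functor is an equivalence.** [cite: MochizukiSemiAnbd2006, Prop 3.6(ii) p.38] -/
theorem temperedFibreFunctor_isEquivalence : (𝒢.temperedFibreFunctor h36).IsEquivalence where
  faithful := 𝒢.temperedFibreFunctor_faithful h36
  full := 𝒢.temperedFibreFunctor_full h36
  essSurj := 𝒢.temperedFibreFunctor_essSurj h36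

/-- **`B^temp(𝒢) ≌ B^temp(π₁^temp(𝒢))`.** [cite: MochizukiSemiAnbd2006, Prop 3.6(ii) p.38] -/
noncomputable def temperedEquiv : BTempCat 𝒢 ≌ BTemp (𝒢.temperedPi h36) :=
  haveI := 𝒢.temperedFibreFunctor_isEquivalence h36
  (𝒢.temperedFibreFunctor h36).asEquivalence

/-- **The tempered fundamental group chart of `𝒢`** (Prop. 3.6 (i)(ii)).
[cite: MochizukiSemiAnbd2006, Prop 3.6(i)(ii) p.38] -/
noncomputable def temperedPiChart : TemperedPiChart 𝒢 where
  G := 𝒢.temperedPi h36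
  isTempered := 𝒢.isTempered_temperedPi h36
  secondCountableTopology := inferInstance
  equiv := 𝒢.temperedEquiv h36

/-- **Proposition 3.6 (i)(ii) holds**: every `𝒢` satisfying the hypotheses of Prop. 3.6 admits a
tempered fundamental group chart. [cite: MochizukiSemiAnbd2006, Prop 3.6(i)(ii) p.38] -/
theorem ExistsTemperedPiChart_holds : ExistsTemperedPiChart.{u} :=
  fun 𝒢 h36 => ⟨𝒢.temperedPiChart h36⟩

end ProfiniteSemiGraph

end Literature.AnabelianGeometry.SemiGraphs
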